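import Summits.BirchSwinnertonDyer.Rank1Residual.Additive.NormedEllipticUnitFamilyOfFrame
import Summits.BirchSwinnertonDyer.Rank1Residual.Additive.RamifiedSevenGenusKummerLayerFields
import Summits.BirchSwinnertonDyer.BirchSwinnertonDyer.Theorems.PrintCf2RubinValueTwoKatoThetaNormChain
import Summits.BirchSwinnertonDyer.BirchSwinnertonDyer.Theorems.PrintCf2RubinValueTwoTwistedKummerScalar
import Summits.BirchSwinnertonDyer.BirchSwinnertonDyer.Theorems.PrintCf2RubinValueTwoLeopoldtTowerNorms
import Summits.BirchSwinnertonDyer.BirchSwinnertonDyer.Theorems.PrintCf2RubinValueTwoLeopoldtEigenLevelMaps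
import Literature.NumberTheory.GaloisRepresentations.AbsGaloisGroupCompact
import HarnessLib

set_option autoImplicit false

/-!
# `𝒞₇` genus road (crux `EllipticUnitValueSevenOfGZK`, K7r), row K2C-15, sequel: THE (H_θ) LETTER of
# `GenusSeven.kummerNonvanishing_of_genusResidue` — rep-coherence of the normed family `θu` with ANY Kato representative one
# `𝔭`-step down the ray-class tower, DISCHARGED from the reading conjunct of `exists_normedEllipticUnitFamily_of_reps`

Cell bsd-cm, seat bsd-cm-prr-ty1 g36 (literature-prover); pen rulings D1053 (2) (reps as parameters), D1069 (F3)/(H_θ), D1089 (T7-B2′: «(H_θ)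
rep-coherence `θu ↔ coset norms of u.z` ← K2C-15's `exists_normedEllipticUnitFamily_of_reps` + [G3] — the K2C-15 successor OWES this exact
letter»).  THEOREMS ONLY (no `def`, no named fact, no `instance`, no notation, no `sorry`); CONDITIONAL on the displayed named fact de Shalit
II.2.5 (i) (`DeShalit1987.prop25_i_normRelation`).

THE TWO LEVELS (numbers, not adjectives).  The value pin `IsNormedEllipticUnitFamily F θu` reads `θu n` as the norm to `Mₙ = e⁻¹F′ₙ` of a
representative `z n` of Kato's unit at the modulus `7^{n+1}𝔣`, `𝔣 = (s)·(d)` (`s² = −7`, `d = |D|`), i.e. at `𝔭^{2n+3}·(d)` (`𝔭 = (s)`,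
`(7) = 𝔭²`); the Kummer unit tower of F∃-2b (`KummerUnitTower.exists_unitTower_of_katoReps_of_reps`) on the frame
`KummerFrame.ofTorsionTower W₂K 7 (7·d)` carries representatives `u.z n` at the modulus `7ⁿ·(7d) = 𝔭^{2n+2}·(d)`, whose level group is
`V n = Gal(K̄/K(7ⁿ·(7d)))` (`KummerUnitTower.V_eq_galFixing_katoLayer`).  These are ADJACENT levels of the `𝔭`-adic ray-class tower
(`7^{n+1}𝔣 = (7ⁿ·(7d))·𝔭`, `katoModulus_conductor_succ_eq`), so «the same representatives» (D1053 (2)) is realised as: `N_{K(𝔭^{2n+3}(d))/K(𝔭^{2n+2}(d))}(z n)`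
and `u.z n` are representatives of the SAME unit `_𝔞z_{𝔭^{2n+2}(d)}` — by de Shalit II.2.5 (i) (branch `𝔩 = 𝔭 ∣ 𝔤`, exponent `1` at the
rigid level `𝔤 = 𝔭^{2n+2}(d)`; the tree's `KatoThetaNorm.algClosureEmb_normOver_step`) the twelfth powers agree — hence equal up to `μ₁₂`,
which is exactly the slack `ζ′` of the (H_θ) letter.

WHAT IS PROVED.
* §1 bookkeeping at the two levels: `katoModulus_span_seven_mul_eq_span` (`7ⁿ·(7d) = (7^{n+1}d)` as ideals),
  `katoModulus_conductor_succ_eq` (`7^{n+1}·((s)(d)) = (7ⁿ·(7d))·(s)`), `seven_dvd_absNorm_katoModulus_span_seven_mul`,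
  `span_sqrt_dvd_katoModulus_span_seven_mul`, `layerFixing_eq_galFixing_preimageField` (`Hₙ = Gal(K̄/e⁻¹F′ₙ)` IS `galFixing K Mₙ`),
  `preimageField_layer_le_katoLayer_span_seven_mul` (`Mₙ ≤ K(7ⁿ·(7d))`, [G3] at `𝔪 = 7ⁿ·(7d)`).
* §2 ★ `exists_normOver_katoLayer_succ_eq_mul` — THE ONE-`𝔭`-STEP NORM RELATION between the two towers: for `z` a representative at
  `7^{n+1}𝔣` and `w` one at `7ⁿ·(7d)` (`n ≥ 1`, same `ι`, same admissible twist `𝔞`), `N_{K(7^{n+1}𝔣)/K(7ⁿ(7d))}(z) = ζ″·w` with `ζ″^{12} = 1`.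
* §3 ★★ `exists_pow_twelve_mul_finprod_smul_eq_of_reading` — THE (H_θ) LETTER of `kummerNonvanishing_of_genusResidue` with `u.z n ↦ w`,
  `(ofTorsionTower …).V n ↦ V` (any `V = galFixing K (K(7ⁿ·(7d)))`), from the READING CONJUNCT of `exists_normedEllipticUnitFamily_of_reps`
  (`θu n = e(N_{K(7^{n+1}𝔣)/Mₙ}(z n))`): `∃ ζ′, ζ′^{12} = 1 ∧ e(ζ′ · ∏ᶠ_{c ∈ Hₙ/V} (out c)·w) = θu n` — norm transitivity
  (`LeopoldtAtV.coe_normOver_normOver`), §2, multiplicativity of `normOver`, and the coset product = `normOver`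
  (`TwistedZeta.prod_smul_eq_normOver_of_eq`).

HONEST LABEL: Galois/unit bookkeeping conditional on one displayed print fact; (H_θ) is DISCHARGED only in the sense «reduced to the reading
conjunct of K2C-15 + a Kato representative at `7ⁿ(7d)` + the identification of `V`», all three of which the K2C-16 constructor supplies by NAME;
nothing about Kato's zeta values proved; no stub closes; stmt-BirchSwinnertonDyer-19945 OPEN; `X12.CMRamifiedSeven` NOT proved; no summit
statement is proved by this seat; BSD claimed for no curve.

## References
* K. Kato, Astérisque 295 (2004), §15.5 (p. 253: «the norm map of `K(p^{n+1}𝔣)/K(pⁿ𝔣)` sends `_𝔞z` to `_𝔞z`»), §15.14 (p. 264). [Kato2004Asterisque]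
* E. de Shalit (1987), II.2.4 (i)(iii), II.2.5 Proposition (i) (pp. 44–48). [deShalit1987]
* J. Johnson-Leung, G. Kings (2011), Prop. 3.3 (1)(2). [JohnsonLeungKings2011]
* J. Neukirch, *Algebraic Number Theory* (1999), Ch. IV §1, Ch. VI §6 (6.2), (6.7). [NeukirchANT1999]
* Tree: `NormedEllipticUnitFamilyOfFrame.lean` (p817832), `RamifiedSevenGenusKummerLayerFields.lean` (`layerFixing`),
  `RamifiedSevenGenusKummerUnitTower.lean` (F∃-2b, p810359), `RamifiedSevenGenusKummerNonvanishing.lean` (L6, p816204: the letter),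
  `Theorems/PrintCf2RubinValueTwoKatoThetaNormChain.lean`, `…TwistedKummerScalar.lean`, `…LeopoldtTowerNorms.lean`, `…LeopoldtEigenLevelMaps.lean`.
-/

noncomputable section

open scoped NumberField
open IsDedekindDomain NumberField Field
open Literature.NumberTheory.IwasawaTheory
open Literature.NumberTheory.NumberFields (rayClassField)
open Literature.NumberTheory.GaloisRepresentations Literature.NumberTheory.GaloisRepresentations.LocalWeilDatum
open Literature.NumberTheory.EllipticCurves
open Literature.NumberTheory.ComplexMultiplication.EllipticUnits
open Summit.BirchSwinnertonDyer.BirchSwinnertonDyer.Theorems.PrintCf2.KatoThetaNorm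
open Summit.BirchSwinnertonDyer.BirchSwinnertonDyer.Theorems.PrintCf2.TwistedZeta (prod_smul_eq_normOver_of_eq finiteIndex_of_isOpen')
open Summit.BirchSwinnertonDyer.BirchSwinnertonDyer.Theorems.PrintCf2.LeopoldtAtV (coe_normOver_normOver coe_normOver_mem normOver_mul
  normOver_pow normOver_one)

namespace Summit.BirchSwinnertonDyer.Rank1Residual.Additive.GenusSeven

variable {K : Type} [Field K] [NumberField K]

/-! ## §1 The two levels `7^{n+1}𝔣 = 𝔭^{2n+3}(d)` and `7ⁿ·(7d) = 𝔭^{2n+2}(d)`; `Hₙ = galFixing K Mₙ`; `Mₙ ≤ K(7ⁿ·(7d))` -/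

omit [NumberField K] in
/-- `7ⁿ·(7d) = (7^{n+1}·d)` as ideals of `O_K`. [cite: Kato2004Asterisque, §15.1 (p. 250)] -/
theorem katoModulus_span_seven_mul_eq_span (d n : ℕ) :
    katoModulus 7 (Ideal.span {((7 * d : ℕ) : 𝓞 K)}) n = Ideal.span {((7 ^ (n + 1) * d : ℕ) : 𝓞 K)} := by
  rw [katoModulus, Ideal.span_singleton_pow, Ideal.span_singleton_mul_span_singleton]
  congr 2
  push_cast
  ring

omit [NumberField K] in
/-- **The two levels are adjacent**: `7^{n+1}·((s)(d)) = (7ⁿ·(7d))·(s)` (`(7) = (s)²`). [cite: Kato2004Asterisque, §15.1 (p. 250)] -/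
theorem katoModulus_conductor_succ_eq (s : 𝓞 K) (d n : ℕ) :
    katoModulus 7 (Ideal.span {s} * Ideal.span {((d : ℕ) : 𝓞 K)}) (n + 1) =
      katoModulus 7 (Ideal.span {((7 * d : ℕ) : 𝓞 K)}) n * Ideal.span {s} := by
  rw [katoModulus, katoModulus, Nat.cast_mul, ← Ideal.span_singleton_mul_span_singleton, pow_succ]
  push_cast
  ring

/-- `7 ∣ N(7ⁿ·(7d))` (`[K : ℚ] = 2`: `N((7d)) = 49d²`). [cite: NeukirchANT1999, Ch. I §8] -/
theorem seven_dvd_absNorm_katoModulus_span_seven_mul (h2 : Module.finrank ℚ K = 2) (d n : ℕ) :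
    7 ∣ Ideal.absNorm (katoModulus 7 (Ideal.span {((7 * d : ℕ) : 𝓞 K)}) n) := by
  rw [katoModulus, map_mul, absNorm_span_natCast h2]
  exact Dvd.dvd.mul_left (Dvd.intro (7 * d ^ 2) (by ring)) _

/-- `(s) ∣ 7ⁿ·(7d)` (`7d = s·(−s·d)`). [cite: NeukirchANT1999, Ch. I §8 (7 ramifies in ℚ(√−7))] -/
theorem span_sqrt_dvd_katoModulus_span_seven_mul (s : 𝓞 K) (hs : (s : K) ^ 2 = -7) (d n : ℕ) :
    Ideal.span {s} ∣ katoModulus 7 (Ideal.span {((7 * d : ℕ) : 𝓞 K)}) n := by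
  rw [katoModulus]
  refine Dvd.dvd.mul_left ?_ _
  rw [Ideal.dvd_span_singleton, Ideal.mem_span_singleton]
  refine ⟨-s * d, ?_⟩
  have hs' : s ^ 2 = -7 := sq_eq_neg_seven_ringOfIntegers hs
  push_cast
  linear_combination (d : 𝓞 K) * hs'

omit [NumberField K] in
/-- **`Hₙ = galFixing K Mₙ`**: the layer group `layerFixing F e n = {σ | e z ∈ F′ₙ → σ z = z}` IS the tree's `galFixing` of the preimage
field `Mₙ = e⁻¹F′ₙ` (`preimageField`). [cite: NeukirchANT1999, Ch. IV §1] -/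
theorem layerFixing_eq_galFixing_preimageField (F : GenusFrame) (e : AlgebraicClosure K →+* AlgebraicClosure ℚ) (n : ℕ)
    (hK : ∀ k : K, e (algebraMap K (AlgebraicClosure K) k) ∈ F.layer n) :
    layerFixing F e n = galFixing K (preimageField e (F.layer n) hK) := by
  ext σ
  rw [GenusFrame.mem_layerFixing_iff, mem_galFixing_iff]
  rfl

/-- **`Mₙ ≤ K(7ⁿ·(7d))`** (`[G3]` at the modulus `7ⁿ·(7d) = (7^{n+1}d)`): every `y ∈ F′ₙ` is `e x` for some `x ∈ K(7ⁿ·(7d))`.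
[cite: NeukirchANT1999, Ch. VI §6 Prop. (6.7) (proof) p. 399] [cite: Kato2004Asterisque, §15.14 (p. 264)] -/
theorem preimageField_layer_le_katoLayer_span_seven_mul (F : GenusFrame) (h2 : Module.finrank ℚ K = 2) {x : K} (hx : x ^ 2 = -7)
    (e : AlgebraicClosure K →+* AlgebraicClosure ℚ) (n : ℕ)
    (hK : ∀ k : K, e (algebraMap K (AlgebraicClosure K) k) ∈ F.layer n) :
    preimageField e (F.layer n) hK ≤ katoLayer 7 (Ideal.span {((7 * F.d : ℕ) : 𝓞 K)}) n := by
  haveI : Fact (Nat.Prime 7) := ⟨Nat.prime_seven⟩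
  haveI : IsTotallyComplex K := isTotallyComplex_of_sq_eq_neg_seven hx
  have _ := h2
  have h0 : (Ideal.span {((7 * F.d : ℕ) : 𝓞 K)} : Ideal (𝓞 K)) ≠ ⊥ := by
    rw [Ne, Ideal.span_singleton_eq_bot]
    exact_mod_cast mul_ne_zero (by norm_num : (7 : ℕ) ≠ 0) F.d_ne_zero
  exact preimageField_le fun y hy =>
    F.exists_mem_rayClassField_apply_eq e (katoModulus_ne_bot 7 _ h0 n) n (katoModulus_span_seven_mul_eq_span F.d n).le y hy

/-! ## §2 ★ The one-`𝔭`-step norm relation between the two towers (de Shalit II.2.5 (i), branch `𝔭 ∣ 𝔤`) -/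

/-- ★ **`N_{K(7^{n+1}𝔣)/K(7ⁿ·(7d))}(z) = ζ″·w`, `ζ″^{12} = 1`** for `𝔣 = (s)·(d)`, `n ≥ 1`, `z` a representative of `_𝔞z_{7^{n+1}𝔣}` and `w`
one of `_𝔞z_{7ⁿ·(7d)}` (same `ι`, same admissible twist `𝔞`): the level `𝔤 = 7ⁿ·(7d)` is rigid (`7 ∣ N𝔤`, `K ∋ √−7`), `7^{n+1}𝔣 = 𝔤·𝔭` with
`𝔭 = (s) ∣ 𝔤`, so de Shalit II.2.5 (i) (exponent `1`) gives `ι̂(N(z^{12})) = Θ(1; 𝔤, 𝔞) = ι̂(w^{12})`; twelfth roots in the field `K̄`.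
[cite: deShalit1987, II.2.5 Proposition (i)] [cite: Kato2004Asterisque, §15.5 (p. 253)] [cite: JohnsonLeungKings2011, Prop. 3.3 (2)] -/
theorem exists_normOver_katoLayer_succ_eq_mul (h25 : DeShalit1987.prop25_i_normRelation) (h2 : Module.finrank ℚ K = 2)
    (s : 𝓞 K) (hs : (s : K) ^ 2 = -7) (ι : K →+* ℂ) {d : ℕ} (hd : d ≠ 0) {n : ℕ} (hn : 1 ≤ n) {𝔞 : Ideal (𝓞 K)}
    (h𝔞 : IsTwist 7 (Ideal.span {s} * Ideal.span {((d : ℕ) : 𝓞 K)}) 𝔞)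
    {z w : (AlgebraicClosure K)ˣ} (hz : IsKatoUnitRep 7 ι (Ideal.span {s} * Ideal.span {((d : ℕ) : 𝓞 K)}) (n + 1) 𝔞 z)
    (hw : IsKatoUnitRep 7 ι (Ideal.span {((7 * d : ℕ) : 𝓞 K)}) n 𝔞 w)
    (hle : katoLayer 7 (Ideal.span {((7 * d : ℕ) : 𝓞 K)}) n ≤ katoLayer 7 (Ideal.span {s} * Ideal.span {((d : ℕ) : 𝓞 K)}) (n + 1)) :
    ∃ ζ : AlgebraicClosure K, ζ ^ 12 = 1 ∧
      ((normOver (katoLayer 7 (Ideal.span {s} * Ideal.span {((d : ℕ) : 𝓞 K)}) (n + 1))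
          (katoLayer 7 (Ideal.span {((7 * d : ℕ) : 𝓞 K)}) n) ⟨(z : AlgebraicClosure K), hz.1.1⟩ :
        katoLayer 7 (Ideal.span {s} * Ideal.span {((d : ℕ) : 𝓞 K)}) (n + 1)) : AlgebraicClosure K) = ζ * (w : AlgebraicClosure K) := by
  haveI : Fact (Nat.Prime 7) := ⟨Nat.prime_seven⟩
  set 𝔣 : Ideal (𝓞 K) := Ideal.span {s} * Ideal.span {((d : ℕ) : 𝓞 K)} with h𝔣def
  set 𝔤 : Ideal (𝓞 K) := katoModulus 7 (Ideal.span {((7 * d : ℕ) : 𝓞 K)}) n with h𝔤def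
  have hs' : s ^ 2 = -7 := sq_eq_neg_seven_ringOfIntegers hs
  -- the prime `𝔭 = (s)`
  let 𝔩 : HeightOneSpectrum (𝓞 K) := ⟨Ideal.span {s}, isPrime_span_sqrt h2 s hs', span_sqrt_ne_bot h2 s hs'⟩
  have hM : katoModulus 7 𝔣 (n + 1) = 𝔤 * 𝔩.asIdeal := katoModulus_conductor_succ_eq s d n
  have h7d0 : (Ideal.span {((7 * d : ℕ) : 𝓞 K)} : Ideal (𝓞 K)) ≠ ⊥ := by
    rw [Ne, Ideal.span_singleton_eq_bot]; exact_mod_cast mul_ne_zero (by norm_num : (7 : ℕ) ≠ 0) hd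
  have h𝔤0 : 𝔤 ≠ ⊥ := katoModulus_ne_bot 7 _ h7d0 n
  have h𝔤1 : 𝔤 ≠ ⊤ := katoModulus_ne_top 7 _ hn
  have hrig : UnitsInjectiveMod 𝔤 := unitsInjectiveMod_of_seven_dvd_absNorm h2 hs (seven_dvd_absNorm_katoModulus_span_seven_mul h2 d n)
  have hdiv : 𝔩.asIdeal ∣ 𝔤 := span_sqrt_dvd_katoModulus_span_seven_mul s hs d n
  have h𝔞0 : 𝔞 ≠ ⊥ := ne_bot_of_isCoprime_katoModulus 7 𝔣 h𝔞.isCoprime_katoModulus_one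
  have h𝔞c : IsCoprime 𝔞 (𝔤 * 𝔩.asIdeal) := hM ▸ h𝔞.isCoprime_katoModulus 7 𝔣 (n + 1)
  -- the lattice data of the two representatives
  obtain ⟨hwmem, Lw, Law, Sw, hLw, hLaw, hSw, hθw⟩ := hw
  obtain ⟨hzmem, Lz, Laz, Sz, hLz, hLaz, hSz, hθz⟩ := hz
  have hLz' : ∀ c : ℂ, c ∈ Lz.lattice ↔ ∃ a ∈ 𝔤 * 𝔩.asIdeal, c = ι (a : K) := by rw [← hM]; exact hLz
  have hz12 : (z : AlgebraicClosure K) ^ 12 ∈ rayClassField K (𝔤 * 𝔩.asIdeal) := by rw [← hM]; exact pow_mem hzmem.1 12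
  have hw12 : (w : AlgebraicClosure K) ^ 12 ∈ rayClassField K 𝔤 := pow_mem hwmem.1 12
  have hstep := algClosureEmb_normOver_step h25 (isImaginaryQuadratic_of_sq h2 hs) ι 𝔩 h𝔤0 h𝔤1 hrig hdiv h𝔞0 h𝔞c hLw hLaw hSw
    hLz' hLaz hSz hw12 hθw hz12 hθz
  rw [← hθw] at hstep
  have h12 : ((normOver (rayClassField K (𝔤 * 𝔩.asIdeal)) (rayClassField K 𝔤) ⟨(z : AlgebraicClosure K) ^ 12, hz12⟩ :
      rayClassField K (𝔤 * 𝔩.asIdeal)) : AlgebraicClosure K) = (w : AlgebraicClosure K) ^ 12 := (algClosureEmb ι).injective hstep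
  -- back to the layers and the 12th power of the norm
  have hpow : ((normOver (katoLayer 7 𝔣 (n + 1)) (katoLayer 7 (Ideal.span {((7 * d : ℕ) : 𝓞 K)}) n)
      ⟨(z : AlgebraicClosure K), hzmem.1⟩ : katoLayer 7 𝔣 (n + 1)) : AlgebraicClosure K) ^ 12 = (w : AlgebraicClosure K) ^ 12 := by
    rw [← h12, coe_normOver_congr (congrArg (rayClassField K) hM) rfl (pow_mem hzmem.1 12) hz12 |>.symm]
    change _ = ((normOver (katoLayer 7 𝔣 (n + 1)) (katoLayer 7 (Ideal.span {((7 * d : ℕ) : 𝓞 K)}) n)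
      (⟨(z : AlgebraicClosure K), hzmem.1⟩ ^ 12) : katoLayer 7 𝔣 (n + 1)) : AlgebraicClosure K)
    rw [normOver_pow hle]
    rfl
  have hw0 : (w : AlgebraicClosure K) ≠ 0 := w.ne_zero
  refine ⟨((normOver (katoLayer 7 𝔣 (n + 1)) (katoLayer 7 (Ideal.span {((7 * d : ℕ) : 𝓞 K)}) n)
      ⟨(z : AlgebraicClosure K), hzmem.1⟩ : katoLayer 7 𝔣 (n + 1)) : AlgebraicClosure K) / (w : AlgebraicClosure K), ?_, ?_⟩
  · rw [div_pow, hpow, div_self (pow_ne_zero _ hw0)]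
  · rw [div_mul_cancel₀ _ hw0]

/-! ## §3 ★★ The (H_θ) letter of `kummerNonvanishing_of_genusResidue`, from the reading conjunct -/

/-- ★★ **THE (H_θ) LETTER, DISCHARGED FROM THE READING.**  Let `F` be a genus frame, `[K : ℚ] = 2`, `s ∈ O_K` with `s² = −7`, `ι`,
`e : K̄ → ℚ̄`, `𝔞` an admissible twist of `𝔣 = (s)·(d)`, `z n` representatives of `_𝔞z_{7^{n+1}𝔣}` and `θu` a family READ as
`θu n = e(N_{K(7^{n+1}𝔣)/Mₙ}(z n))`, `Mₙ = e⁻¹F′ₙ` (the conjunct exported by `exists_normedEllipticUnitFamily_of_reps`).  Then for every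
`n ≥ 1`, every subgroup `V = Gal(K̄/K(7ⁿ·(7d)))` (e.g. the level `V n` of `KummerFrame.ofTorsionTower W₂K 7 (7d)`,
`KummerUnitTower.V_eq_galFixing_katoLayer`) and every representative `w` of `_𝔞z_{7ⁿ·(7d)}` (e.g. the unit `u.z n` of F∃-2b's tower):
`∃ ζ′, ζ′^{12} = 1 ∧ e(ζ′ · ∏ᶠ_{c ∈ Hₙ/V} (out c)·w) = θu n` — VERBATIM the binder `hθ` of `GenusSeven.kummerNonvanishing_of_genusResidue` at
`u.z n := w`, `(ofTorsionTower …).V n := V`.  Proof: `N_{K(7^{n+1}𝔣)/Mₙ} = N_{K(7ⁿ(7d))/Mₙ} ∘ N_{K(7^{n+1}𝔣)/K(7ⁿ(7d))}` (transitivity),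
§2 (`N(z n) = ζ″·w`), multiplicativity (`ζ′ := N_{K(7ⁿ(7d))/Mₙ}(ζ″)`, a twelfth root of unity), and the coset product over `Hₙ/V` with
`Quotient.out` representatives IS `N_{K(7ⁿ(7d))/Mₙ}` (`prod_smul_eq_normOver_of_eq`, `Hₙ = galFixing K Mₙ`).
[cite: Kato2004Asterisque, §15.5 (p. 253) and 15.14 (p. 264)] [cite: deShalit1987, II.2.5 Proposition (i)] [cite: NeukirchANT1999, Ch. IV §1] -/
theorem exists_pow_twelve_mul_finprod_smul_eq_of_reading (h25 : DeShalit1987.prop25_i_normRelation) (F : GenusFrame)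
    (h2 : Module.finrank ℚ K = 2) (s : 𝓞 K) (hs : (s : K) ^ 2 = -7) (ι : K →+* ℂ)
    (e : AlgebraicClosure K →+* AlgebraicClosure ℚ) {𝔞 : Ideal (𝓞 K)}
    (h𝔞 : IsTwist 7 (Ideal.span {s} * Ideal.span {((F.d : ℕ) : 𝓞 K)}) 𝔞)
    {θu : ∀ n : ℕ, globalUnitsOf (F.layer n)} {z : ℕ → (AlgebraicClosure K)ˣ}
    (hz : ∀ n : ℕ, IsKatoUnitRep 7 ι (Ideal.span {s} * Ideal.span {((F.d : ℕ) : 𝓞 K)}) (n + 1) 𝔞 (z n))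
    (hread : ∀ n : ℕ, (((θu n : globalUnitsOf (F.layer n)) : (AlgebraicClosure ℚ)ˣ) : AlgebraicClosure ℚ) =
      e ((normOver (katoLayer 7 (Ideal.span {s} * Ideal.span {((F.d : ℕ) : 𝓞 K)}) (n + 1))
          (preimageField e (F.layer n) (fun k => GenusFrame.apply_algebraMap_mem_layer h2 hs e n k))
          ⟨(z n : AlgebraicClosure K), (hz n).1.1⟩ :
            katoLayer 7 (Ideal.span {s} * Ideal.span {((F.d : ℕ) : 𝓞 K)}) (n + 1)) : AlgebraicClosure K))
    {n : ℕ} (hn : 1 ≤ n) {V : Subgroup (absoluteGaloisGroup K)}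
    (hV : V = galFixing K (katoLayer 7 (Ideal.span {((7 * F.d : ℕ) : 𝓞 K)}) n))
    {w : (AlgebraicClosure K)ˣ} (hw : IsKatoUnitRep 7 ι (Ideal.span {((7 * F.d : ℕ) : 𝓞 K)}) n 𝔞 w) :
    ∃ ζ' : AlgebraicClosure K, ζ' ^ 12 = 1 ∧
      e (ζ' * ∏ᶠ c : layerFixing F e n ⧸ V.subgroupOf (layerFixing F e n),
          (((Quotient.out c : layerFixing F e n) : absoluteGaloisGroup K) • (w : (AlgebraicClosure K)ˣ) : AlgebraicClosure K)) =
        ((θu n : (AlgebraicClosure ℚ)ˣ) : AlgebraicClosure ℚ) := by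
  classical
  haveI : Fact (Nat.Prime 7) := ⟨Nat.prime_seven⟩
  -- the fields `Mₙ ≤ L₀ = K(7ⁿ(7d)) ≤ L₁ = K(7^{n+1}𝔣)` and the groups `Hₙ = galFixing K Mₙ ≥ V = galFixing K L₀`
  set 𝔣 : Ideal (𝓞 K) := Ideal.span {s} * Ideal.span {((F.d : ℕ) : 𝓞 K)} with h𝔣def
  have hK : ∀ k : K, e (algebraMap K (AlgebraicClosure K) k) ∈ F.layer n := fun k => GenusFrame.apply_algebraMap_mem_layer h2 hs e n k
  set M : IntermediateField K (AlgebraicClosure K) := preimageField e (F.layer n) hK with hMdef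
  set L₀ : IntermediateField K (AlgebraicClosure K) := katoLayer 7 (Ideal.span {((7 * F.d : ℕ) : 𝓞 K)}) n with hL₀def
  set L₁ : IntermediateField K (AlgebraicClosure K) := katoLayer 7 𝔣 (n + 1) with hL₁def
  have h7d0 : (Ideal.span {((7 * F.d : ℕ) : 𝓞 K)} : Ideal (𝓞 K)) ≠ ⊥ := by
    rw [Ne, Ideal.span_singleton_eq_bot]; exact_mod_cast mul_ne_zero (by norm_num : (7 : ℕ) ≠ 0) F.d_ne_zero
  have hML₀ : M ≤ L₀ := preimageField_layer_le_katoLayer_span_seven_mul F h2 hs e n hK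
  have hL₀L₁ : L₀ ≤ L₁ := by
    have h := rayClassField_le_of_mul (K := K) (𝔤 := katoModulus 7 (Ideal.span {((7 * F.d : ℕ) : 𝓞 K)}) n) (P := Ideal.span {s})
      (by rw [← katoModulus_conductor_succ_eq]
          exact katoModulus_ne_bot 7 𝔣 (span_sqrt_mul_span_natCast_ne_bot h2 s hs F.d_ne_zero) (n + 1))
    rw [← katoModulus_conductor_succ_eq] at h
    exact h
  have hHM : layerFixing F e n = galFixing K M := layerFixing_eq_galFixing_preimageField F e n hK
  -- finiteness of `Hₙ / V`
  haveI : CompactSpace (absoluteGaloisGroup K) := absoluteGaloisGroup_compactSpace K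
  haveI hVfin : V.FiniteIndex := by rw [hV]; exact finiteIndex_of_isOpen' (isOpen_galFixing K L₀)
  letI : Fintype (layerFixing F e n ⧸ V.subgroupOf (layerFixing F e n)) := Fintype.ofFinite _
  -- transitivity of the norm
  set z₁ : L₁ := ⟨(z n : AlgebraicClosure K), (hz n).1.1⟩ with hz₁def
  have htrans := coe_normOver_normOver hML₀ hL₀L₁ z₁
  -- the one-`𝔭`-step relation `N_{L₁/L₀}(z n) = ζ″·w`
  obtain ⟨ζ'', hζ''12, hNz⟩ := exists_normOver_katoLayer_succ_eq_mul h25 h2 s hs ι F.d_ne_zero hn h𝔞 (hz n) hw hL₀L₁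
  have hζ''mem : ζ'' ∈ L₀ := by
    have h1 : ζ'' = ((normOver L₁ L₀ z₁ : L₁) : AlgebraicClosure K) / (w : AlgebraicClosure K) := by
      rw [hNz, mul_div_cancel_right₀ _ w.ne_zero]
    rw [h1]
    exact div_mem (coe_normOver_mem hL₀L₁ z₁) hw.1.1
  set ζL : L₀ := ⟨ζ'', hζ''mem⟩ with hζLdef
  set wL : L₀ := ⟨(w : AlgebraicClosure K), hw.1.1⟩ with hwLdef
  have helt : (⟨((normOver L₁ L₀ z₁ : L₁) : AlgebraicClosure K), coe_normOver_mem hL₀L₁ z₁⟩ : L₀) = ζL * wL :=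
    Subtype.ext hNz
  -- `ζ′ := N_{L₀/M}(ζ″)`, a twelfth root of unity
  have hζ'12 : ((normOver L₀ M ζL : L₀) : AlgebraicClosure K) ^ 12 = 1 := by
    have h1 : ζL ^ 12 = 1 := Subtype.ext (by rw [SubmonoidClass.coe_pow]; exact hζ''12)
    rw [← SubmonoidClass.coe_pow, ← normOver_pow hML₀, h1, normOver_one hML₀, OneMemClass.coe_one]
  -- the coset product is `N_{L₀/M}(w)`
  have hprod : ∏ c : layerFixing F e n ⧸ V.subgroupOf (layerFixing F e n),
      (((Quotient.out c : layerFixing F e n) : absoluteGaloisGroup K) • (w : (AlgebraicClosure K)ˣ) : AlgebraicClosure K) =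
        ((normOver L₀ M wL : L₀) : AlgebraicClosure K) := by
    rw [← prod_smul_eq_normOver_of_eq hML₀ hHM hV (s := Quotient.out) (fun c => Quotient.out_eq c) wL]
  refine ⟨((normOver L₀ M ζL : L₀) : AlgebraicClosure K), hζ'12, ?_⟩
  rw [hread n, finprod_eq_prod_of_fintype, hprod, ← htrans, helt, normOver_mul hML₀, MulMemClass.coe_mul]

end Summit.BirchSwinnertonDyer.Rank1Residual.Additive.GenusSeven

end
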